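import Mathlib.LinearAlgebra.Matrix.Rank
import Mathlib.LinearAlgebra.Matrix.GeneralLinearGroup.Defs
import Mathlib.LinearAlgebra.Matrix.ToLin
import Mathlib.LinearAlgebra.Matrix.NonsingularInverse
import Mathlib.LinearAlgebra.FiniteDimensional.Lemmas
import Mathlib.LinearAlgebra.Isomorphisms
import Mathlib.LinearAlgebra.Projection
import HarnessLib

/-!
# Matrices of equal rank are equivalent: the orbits of `GL_n × GL_s` on `F^{n×s}` are the rank classes

Topic `LinearAlgebra/Matrix`; namespace `Literature.LinearAlgebra.Matrix`. Pure linear algebra (Mathlib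
only), everything PROVED; the rectangular companion of `RankNormalForm.lean` (square matrices,
`A = P E_r Q`).

* `exists_linearEquiv_comp_comp_eq` — two linear maps `f, g : V → W` between finite-dimensional spaces
  with `dim range f = dim range g` are *equivalent*: `θ₂ ∘ f ∘ θ₁ = g` for automorphisms `θ₁` of `V`
  and `θ₂` of `W` (complements of the kernels and of the images, matched by dimension).
* `exists_gl_mul_mul_gl_eq_of_rank_eq` — for `n × s` matrices over a field, `rank A = rank B` implies
  `P A Q = B` for some `P ∈ GL_n(F)`, `Q ∈ GL_s(F)`; with the converse (`rank (P A Q) = rank A`,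
  Mathlib) this is `rank_eq_iff_exists_gl_mul_mul_gl_eq`: **the group `G^{(n,s)} = GL_n × GL_s`
  acting by `A ↦ P A Q` has the rank classes as its orbits** — Nazarov 2023, Lemma 5 ("the group
  `G^{(n,s)}` splits `L^{(n,s)}` into exactly `n + 1` orbits (`n ≤ s`), one for each rank
  `r = 0, 1, …, n`", proved there from the normal form `E^{(n,s,r)}` [Kurosh, p. 183]).

## References

* A. A. Nazarov, Vestn. Mosk. Univ. Ser. 15 Vychisl. Mat. Kibern. 2023, no. 4, 41–53, Lemma 5, 1).
  [Nazarov2023FiniteFieldLB]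
* A. G. Kurosh, *Kurs vysshei algebry*, Nauka 1965, p. 183 (the normal form of a rectangular matrix
  under row and column operations), as cited there.
-/

noncomputable section

open Module Submodule Matrix

namespace Literature.LinearAlgebra.Matrix

variable {F : Type*} [Field F]

section LinearMaps

variable {V W : Type*} [AddCommGroup V] [Module F V] [AddCommGroup W] [Module F W]

/-- A complement of the kernel maps isomorphically onto the image. [folklore] -/
private def complKerEquivRange (f : V →ₗ[F] W) (C : Submodule F V) (hC : IsCompl (LinearMap.ker f) C) :
    C ≃ₗ[F] LinearMap.range f :=
  (Submodule.quotientEquivOfIsCompl _ C hC).symm.trans f.quotKerEquivRange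

/-- The isomorphism `C ≃ range f` is `f` itself. [folklore] -/
private theorem complKerEquivRange_apply (f : V →ₗ[F] W) (C : Submodule F V)
    (hC : IsCompl (LinearMap.ker f) C) (x : C) : (complKerEquivRange f C hC x : W) = f x := by
  simp [complKerEquivRange, LinearMap.quotKerEquivRange_apply_mk]

variable [FiniteDimensional F V] [FiniteDimensional F W]

/-- **Linear maps of equal rank are equivalent**: if `dim range f = dim range g` for
`f, g : V → W` (finite-dimensional), then `θ₂ ∘ f ∘ θ₁ = g` for some automorphisms `θ₁` of `V` and
`θ₂` of `W`. [cite: Nazarov2023FiniteFieldLB, Lemma 5, 1) (proof)] -/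
theorem exists_linearEquiv_comp_comp_eq (f g : V →ₗ[F] W)
    (h : finrank F (LinearMap.range f) = finrank F (LinearMap.range g)) :
    ∃ (θ₁ : V ≃ₗ[F] V) (θ₂ : W ≃ₗ[F] W), ∀ v, θ₂ (f (θ₁ v)) = g v := by
  obtain ⟨Cf, hCf⟩ := Submodule.exists_isCompl (LinearMap.ker f)
  obtain ⟨Cg, hCg⟩ := Submodule.exists_isCompl (LinearMap.ker g)
  obtain ⟨Df, hDf⟩ := Submodule.exists_isCompl (LinearMap.range f)
  obtain ⟨Dg, hDg⟩ := Submodule.exists_isCompl (LinearMap.range g)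
  have hK : finrank F (LinearMap.ker g) = finrank F (LinearMap.ker f) := by
    have h1 := LinearMap.finrank_range_add_finrank_ker f
    have h2 := LinearMap.finrank_range_add_finrank_ker g
    omega
  have hD : finrank F Df = finrank F Dg := by
    have h1 := Submodule.finrank_add_eq_of_isCompl hDf
    have h2 := Submodule.finrank_add_eq_of_isCompl hDg
    omega
  let φf := complKerEquivRange f Cf hCf
  let φg := complKerEquivRange g Cg hCg
  let eK : LinearMap.ker g ≃ₗ[F] LinearMap.ker f := LinearEquiv.ofFinrankEq _ _ hK
  let eR : LinearMap.range f ≃ₗ[F] LinearMap.range g := LinearEquiv.ofFinrankEq _ _ h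
  let eC : Cg ≃ₗ[F] Cf := φg.trans (eR.symm.trans φf.symm)
  let eD : Df ≃ₗ[F] Dg := LinearEquiv.ofFinrankEq _ _ hD
  let θ₁ : V ≃ₗ[F] V := ((Submodule.prodEquivOfIsCompl _ Cg hCg).symm.trans (eK.prodCongr eC)).trans
    (Submodule.prodEquivOfIsCompl _ Cf hCf)
  let θ₂ : W ≃ₗ[F] W := ((Submodule.prodEquivOfIsCompl _ Df hDf).symm.trans (eR.prodCongr eD)).trans
    (Submodule.prodEquivOfIsCompl _ Dg hDg)
  refine ⟨θ₁, θ₂, fun v => ?_⟩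
  -- decompose `v = k + c`, `k ∈ ker g`, `c ∈ Cg`
  set p := (Submodule.prodEquivOfIsCompl _ Cg hCg).symm v with hp
  have hv : v = (p.1 : V) + (p.2 : V) := by
    have := (Submodule.prodEquivOfIsCompl _ Cg hCg).apply_symm_apply v
    rw [← hp, Submodule.coe_prodEquivOfIsCompl'] at this
    exact this.symm
  -- `θ₁ v = eK k + eC c`, so `f (θ₁ v) = f (eC c) = eR⁻¹ (φg c)`
  have h1 : θ₁ v = (eK p.1 : V) + (eC p.2 : V) := by
    simp only [θ₁, LinearEquiv.trans_apply, ← hp, LinearEquiv.prodCongr_apply,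
      Submodule.coe_prodEquivOfIsCompl']
  have h2 : f (θ₁ v) = ((eR.symm (φg p.2) : LinearMap.range f) : W) := by
    rw [h1, map_add, show f (eK p.1 : V) = 0 from LinearMap.mem_ker.1 (eK p.1).2, zero_add]
    have : (eC p.2 : V) = ((φf.symm (eR.symm (φg p.2)) : Cf) : V) := rfl
    rw [this, ← complKerEquivRange_apply f Cf hCf, show complKerEquivRange f Cf hCf = φf from rfl,
      LinearEquiv.apply_symm_apply]
  -- `θ₂` restricted to `range f` is `eR`
  have h3 : ∀ y : LinearMap.range f, θ₂ (y : W) = ((eR y : LinearMap.range g) : W) := by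
    intro y
    have hy : (Submodule.prodEquivOfIsCompl _ Df hDf).symm (y : W) = (y, (0 : Df)) :=
      Submodule.prodEquivOfIsCompl_symm_apply_left _ _ hDf y
    simp only [θ₂, LinearEquiv.trans_apply, hy, LinearEquiv.prodCongr_apply, map_zero,
      Submodule.coe_prodEquivOfIsCompl', Submodule.coe_zero, add_zero]
  rw [h2, h3, LinearEquiv.apply_symm_apply, complKerEquivRange_apply, hv, map_add,
    show g (p.1 : V) = 0 from LinearMap.mem_ker.1 p.1.2, zero_add]

end LinearMaps

section Matrices

variable {n s : Type*} [Fintype n] [Fintype s] [DecidableEq n] [DecidableEq s]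

/-- The invertible matrix of an automorphism of `F^n` (column-vector convention:
`glOfLinearEquiv θ *ᵥ v = θ v`). [folklore] -/
def glOfLinearEquiv (θ : (n → F) ≃ₗ[F] (n → F)) : GL n F :=
  Matrix.GeneralLinearGroup.mkOfDetNeZero (LinearMap.toMatrix' θ.toLinearMap) (by
    refine Matrix.det_ne_zero_of_right_inverse (B := LinearMap.toMatrix' θ.symm.toLinearMap) ?_
    rw [← LinearMap.toMatrix'_comp]
    have : θ.toLinearMap.comp θ.symm.toLinearMap = LinearMap.id := by
      ext v i
      simp
    rw [this, LinearMap.toMatrix'_id])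

/-- `glOfLinearEquiv θ *ᵥ v = θ v`. [folklore] -/
private theorem glOfLinearEquiv_mulVec (θ : (n → F) ≃ₗ[F] (n → F)) (v : n → F) :
    (glOfLinearEquiv θ : Matrix n n F) *ᵥ v = θ v := by
  simp only [glOfLinearEquiv, Matrix.GeneralLinearGroup.val_mkOfDetNeZero, LinearMap.toMatrix'_mulVec,
    LinearEquiv.coe_coe]

/-- **Matrices of equal rank are equivalent**: `rank A = rank B` for `A, B ∈ F^{n×s}` implies
`P A Q = B` with `P ∈ GL_n(F)`, `Q ∈ GL_s(F)`. [cite: Nazarov2023FiniteFieldLB, Lemma 5, 1)] -/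
theorem exists_gl_mul_mul_gl_eq_of_rank_eq (A B : Matrix n s F) (h : A.rank = B.rank) :
    ∃ (P : GL n F) (Q : GL s F), (P : Matrix n n F) * A * (Q : Matrix s s F) = B := by
  obtain ⟨θ₁, θ₂, hθ⟩ := exists_linearEquiv_comp_comp_eq A.mulVecLin B.mulVecLin h
  refine ⟨glOfLinearEquiv θ₂, glOfLinearEquiv θ₁, ?_⟩
  apply Matrix.toLin'.injective
  apply LinearMap.ext
  intro v
  rw [Matrix.toLin'_apply, Matrix.toLin'_apply, ← Matrix.mulVec_mulVec, ← Matrix.mulVec_mulVec,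
    glOfLinearEquiv_mulVec, glOfLinearEquiv_mulVec]
  exact hθ v

/-- Conversely `rank (P A Q) = rank A` (Mathlib), so **the orbits of `GL_n(F) × GL_s(F)` on `F^{n×s}`
(`A ↦ P A Q`) are exactly the rank classes** — Nazarov 2023, Lemma 5, 1): "`G^{(n,s)}` splits
`L^{(n,s)}` into `n + 1` orbits, one for each rank". [cite: Nazarov2023FiniteFieldLB, Lemma 5, 1)] -/
theorem rank_eq_iff_exists_gl_mul_mul_gl_eq (A B : Matrix n s F) :
    A.rank = B.rank ↔ ∃ (P : GL n F) (Q : GL s F), (P : Matrix n n F) * A * (Q : Matrix s s F) = B := by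
  refine ⟨exists_gl_mul_mul_gl_eq_of_rank_eq A B, ?_⟩
  rintro ⟨P, Q, rfl⟩
  have hP : IsUnit (P : Matrix n n F).det := (Matrix.isUnits_det_units P)
  have hQ : IsUnit (Q : Matrix s s F).det := (Matrix.isUnits_det_units Q)
  rw [Matrix.rank_mul_eq_left_of_isUnit_det _ _ hQ, Matrix.rank_mul_eq_right_of_isUnit_det _ _ hP]

end Matrices

end Literature.LinearAlgebra.Matrix

end
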